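import Literature.NumberTheory.LFunctions.ZeroGaps
import Literature.NumberTheory.LFunctions.ZeroStatisticsProofs
import Literature.NumberTheory.LFunctions.ZetaFirstZeroCertificate
import Mathlib.Analysis.SpecialFunctions.Integrals.Basic
import Mathlib.Analysis.SpecialFunctions.Trigonometric.Sinc
import Mathlib.Analysis.Complex.Trigonometric
import Mathlib.Analysis.Real.Pi.Bounds
import HarnessLib

/-!
# Montgomery's pair correlation conjecture gives a positive proportion of small gaps at every scale

Trunk T-ANT (`Literature/NumberTheory/LFunctions`). Proofs only (no definitions, no named facts).
Companion of `ZeroStatistics.lean` (`MontgomeryPairCorrelation`, rh.S31) and `ZeroGaps.lean`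
(`zetaNormalizedGap`, the Selberg–Fujii idiom "for a positive proportion of `n`").

## Main result

* `MontgomeryPairCorrelation.smallGaps` — assuming Montgomery's pair correlation conjecture
  (Montgomery 1973, (12), in the `N(T)`-normalised form of Titchmarsh–Heath-Brown §14.34 with
  Montgomery's `δ`-term, as recorded by `Literature.NumberTheory.LFunctions.MontgomeryPairCorrelation`):
  for every `μ > 0` there are `A > 0` and `T₀` such that for all `T ≥ T₀`
  `#{n < N(T) : 0 < (γ_{n+1} − γ_n)/(2π/log γ_n) ≤ μ} ≥ A · N(T)`.
  This is the deduction used (in one sentence, "assuming the Riemann Hypothesis and pair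
  correlation … for at least one of every such pair the corresponding zero cannot appear") by
  Bombieri–Garrett, *Designed pseudo-Laplacians* (2020), §7.5, Corollary 69; it feeds the barrier
  `Literature/Barriers/RiemannHypothesis/PseudoLaplacianSpacing.lean` through its hypothesis
  `SmallGapsBelowHalfSpacing` (`PseudoLaplacianSpacingProofs.lean`). The Riemann Hypothesis plays
  no role: the tree's pair correlation conjecture is a statement about the ordinates.

## The proof (ours; the sources do not spell it out)

Fix `0 < β ≤ 3/10` (`β = min μ 3/10`), `L = log T`, and bins of width `w = 2π(β/10)/L` on the
real line, index `i` lying in bin `⌊γ_i / w⌋`. Write `I = {n < N(T)}`,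
`P = pairCorrelationCount (β/2) β T` (ordered pairs `(j, i) ∈ I²` with
`2π(β/2)/L ≤ γ_j − γ_i ≤ 2πβ/L`), `E₀ = #{(j, i) ∈ I² : j ≠ i, same bin}`,
`S = #{i ∈ I : ∃ j ∈ I, 2π(β/2)/L ≤ γ_j − γ_i ≤ 2πβ/L}` (left ends) and
`G = #{i ∈ I : 0 < γ_{i+1} − γ_i ≤ 2πβ/L}`.
1. *Binning* (`PairCorrelationSmallGaps.two_mul_card_window_le`): `2P ≤ 11 (2E₀ + 3S)`. Every
   counted pair `(j, i)` has `i ∈ S` and bin offset `t ∈ {0, …, 10}`; for fixed `t`, decomposing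
   by the bin `k` of `i`, the pairs number at most `∑_k a_{k+t} s_k` (`a_k`, `s_k` the number of
   indices of `I`, resp. of left ends, in bin `k`), and `2as ≤ a(a−1) + s(s−1) + 3s`, while
   `∑_k a_k(a_k − 1) = E₀`, `∑_k s_k(s_k−1) ≤ E₀`, `∑_k s_k = S`.
2. *Left ends to consecutive gaps* (`card_leftEnds_le`): `S ≤ G + E₀` — a left end `i` with
   `γ_{i+1} = γ_i` gives the same-bin pair `(i+1, i)`, otherwise `0 < γ_{i+1} − γ_i ≤ 2πβ/L`
   (ordinates are non-decreasing, `zetaOrdinate_mono_holds`).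
3. `E₀ + N(T) ≤ pairCorrelationCount (−β/10) (β/10) T` (same bin ⇒ less than `w` apart; the
   diagonal is Montgomery's `δ`-term), and `G ≤ #{n < N(T) : 0 < δ_n ≤ β}` since
   `14 < γ_n ≤ T` gives `0 < log γ_n ≤ log T` (`fourteen_lt_zetaOrdinate_zero_holds`,
   `mem_zeroIndexSet_iff_holds`).
4. *Analysis*: `x²/7 ≤ 1 − sinc² x` on `(0, 1]` (`Real.sin_bound`) and `1 − sinc² x ≤ x²/3` on `ℝ`
   (`Real.sin_gt_sub_cube`) give `∫_{β/2}^{β} (1 − (sin πu/πu)²) du ≥ 7β³/24` and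
   `∫_{−β/10}^{β/10} (1 − (sin πu/πu)²) du ≤ β³/300`; pair correlation then gives, for large `T`,
   `P ≥ (7β³/24 − β³/300) N(T)` and `E₀ ≤ (2β³/300) N(T)`, whence `G ≥ (β³/200) N(T)`.

## References

* H. L. Montgomery, *The pair correlation of zeros of the zeta function*, Proc. Sympos. Pure
  Math. 24 (1973), 181–193, (12). [key `Montgomery1973`]
* E. Bombieri, P. Garrett, *Designed pseudo-Laplacians*, arXiv:2002.07929 (2020), §7.5,
  Corollary 69 and the paragraph following Remark 71. [key `BombieriGarrett2020`]
* E. C. Titchmarsh, *The Theory of the Riemann Zeta-Function*, 2nd ed. (1986), §9.25, §14.34.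
  [key `Titchmarsh1986`]
-/

noncomputable section

open Real Filter
open scoped Topology

namespace Literature.NumberTheory.LFunctions

namespace PairCorrelationSmallGaps

/-! ## Analysis: the pair-correlation density near `0` -/

/-- `1 − sinc² x ≤ x²/3` for every real `x` (from `x − x³/6 < sin x`, `x > 0`). [folklore] -/
theorem one_sub_sinc_sq_le (x : ℝ) : 1 - Real.sinc x ^ 2 ≤ x ^ 2 / 3 := by
  suffices H : ∀ y : ℝ, 0 < y → 1 - Real.sinc y ^ 2 ≤ y ^ 2 / 3 by
    rcases lt_trichotomy x 0 with h | h | h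
    · simpa using H (-x) (neg_pos.2 h)
    · subst h; simp
    · exact H x h
  intro y hy
  rw [Real.sinc_of_ne_zero hy.ne', div_pow]
  have h1 := Real.sin_gt_sub_cube hy
  have hy2 : 0 < y ^ 2 := by positivity
  rw [sub_le_comm, le_div_iff₀ hy2]
  by_cases h6 : y ^ 2 ≤ 6
  · have hpos : 0 ≤ y - y ^ 3 / 6 := by nlinarith
    have h2 : (y - y ^ 3 / 6) ^ 2 ≤ Real.sin y ^ 2 := pow_le_pow_left₀ hpos h1.le 2
    nlinarith [sq_nonneg (y ^ 3)]
  · push Not at h6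
    nlinarith [sq_nonneg (Real.sin y)]

/-- `x²/7 ≤ 1 − sinc² x` for `0 < x ≤ 1` (from `|sin x − (x − x³/6)| ≤ |x|⁵/100`). [folklore] -/
theorem sq_div_le_one_sub_sinc_sq {x : ℝ} (hx : 0 < x) (hx1 : x ≤ 1) :
    x ^ 2 / 7 ≤ 1 - Real.sinc x ^ 2 := by
  rw [Real.sinc_of_ne_zero hx.ne', div_pow]
  have hb := Real.sin_bound (show |x| ≤ 1 by rwa [abs_of_pos hx])
  rw [abs_of_pos hx] at hb
  have hs1 : Real.sin x ≤ x - x ^ 3 / 6 + x ^ 5 / 100 := by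
    have := (abs_le.1 hb).2; linarith
  have hs0 : 0 ≤ Real.sin x :=
    Real.sin_nonneg_of_nonneg_of_le_pi hx.le (by linarith [Real.pi_gt_three])
  have hx2 : 0 < x ^ 2 := by positivity
  rw [le_sub_comm, div_le_iff₀ hx2]
  have hx21 : x ^ 2 ≤ 1 := by nlinarith
  have hx5 : x ^ 5 ≤ x ^ 3 := by nlinarith [pow_pos hx 3]
  have hz : Real.sin x ≤ x - 47 / 300 * x ^ 3 := by linarith
  have hsq : Real.sin x ^ 2 ≤ (x - 47 / 300 * x ^ 3) ^ 2 := pow_le_pow_left₀ hs0 hz 2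
  nlinarith [hsq, mul_nonneg (mul_nonneg hx2.le hx2.le) (sub_nonneg.2 hx21), mul_nonneg hx2.le hx2.le]

/-- The pair-correlation density `1 − (sin πu / πu)²` is continuous. [folklore] -/
theorem continuous_sineGap : Continuous fun u : ℝ ↦ 1 - sineKernel u ^ 2 := by
  unfold sineKernel
  fun_prop

/-- `∫_α^β (1 − (sin πu/πu)²) du ≥ (β³ − α³)/3` for `0 < α ≤ β ≤ 3/10` (there `πu ≤ 1` and the
integrand is `≥ (πu)²/7 ≥ u²`). [folklore] -/
theorem integral_sineGap_ge {α β : ℝ} (hα : 0 < α) (hαβ : α ≤ β) (hβ : β ≤ 3 / 10) :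
    (β ^ 3 - α ^ 3) / 3 ≤ ∫ u in α..β, (1 - sineKernel u ^ 2) := by
  have hint : ∫ u in α..β, u ^ 2 = (β ^ 3 - α ^ 3) / 3 := by
    rw [integral_pow]; norm_num
  rw [← hint]
  refine intervalIntegral.integral_mono_on hαβ ?_ ?_ fun u hu ↦ ?_
  · exact (continuous_pow 2).intervalIntegrable _ _
  · exact continuous_sineGap.intervalIntegrable _ _
  · have hu0 : 0 < u := hα.trans_le hu.1
    have hx0 : 0 < π * u := mul_pos Real.pi_pos hu0
    have hx1 : π * u ≤ 1 := by
      calc π * u ≤ π * (3 / 10) := by gcongr; exact hu.2.trans hβ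
        _ ≤ 1 := by linarith [Real.pi_lt_d2]
    have h := sq_div_le_one_sub_sinc_sq hx0 hx1
    have hπ2 : 9 < π ^ 2 := by nlinarith [Real.pi_gt_three]
    show u ^ 2 ≤ 1 - sineKernel u ^ 2
    unfold sineKernel
    nlinarith [mul_le_mul_of_nonneg_right hπ2.le (sq_nonneg u), mul_pow π u 2]

/-- `∫_{−η}^{η} (1 − (sin πu/πu)²) du ≤ 10 η³/3` for `η ≥ 0` (the integrand is
`≤ (πu)²/3 ≤ 5u²`). [folklore] -/
theorem integral_sineGap_le {η : ℝ} (hη : 0 ≤ η) :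
    ∫ u in (-η)..η, (1 - sineKernel u ^ 2) ≤ 10 * η ^ 3 / 3 := by
  have hint : ∫ u in (-η)..η, 5 * u ^ 2 = 10 * η ^ 3 / 3 := by
    rw [intervalIntegral.integral_const_mul, integral_pow]; ring
  rw [← hint]
  refine intervalIntegral.integral_mono_on (by linarith) ?_ ?_ fun u _ ↦ ?_
  · exact continuous_sineGap.intervalIntegrable _ _
  · exact (continuous_const.mul (continuous_pow 2)).intervalIntegrable _ _
  · have h := one_sub_sinc_sq_le (π * u)
    have hπ2 : π ^ 2 ≤ 10 := by nlinarith [Real.pi_lt_d2, Real.pi_pos]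
    show 1 - sineKernel u ^ 2 ≤ 5 * u ^ 2
    unfold sineKernel
    nlinarith [mul_le_mul_of_nonneg_right hπ2 (sq_nonneg u), mul_pow π u 2]

/-! ## Binning: a combinatorial inequality for pair counts of a real sequence

Bins of width `w > 0`: the index `i` lies in bin `⌊γ i / w⌋ ∈ ℤ`. -/

/-- Reals with the same bin `⌊x/w⌋ = ⌊y/w⌋` (`w > 0`) are less than `w` apart. [folklore] -/
theorem abs_sub_lt_of_floor_div_eq {w : ℝ} (hw : 0 < w) {x y : ℝ} (h : ⌊x / w⌋ = ⌊y / w⌋) :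
    |x - y| < w := by
  have := Int.abs_sub_lt_one_of_floor_eq_floor h
  rwa [← sub_div, abs_div, abs_of_pos hw, div_lt_one hw] at this

/-- A real at most `m w` to the right of `x` is at most `m` bins to the right. [folklore] -/
theorem floor_div_le_floor_div_add {w : ℝ} (hw : 0 < w) {x y : ℝ} {m : ℕ} (h : y ≤ x + m * w) :
    ⌊y / w⌋ ≤ ⌊x / w⌋ + m := by
  have h' : y / w ≤ x / w + m := by
    calc y / w ≤ (x + m * w) / w := div_le_div_of_nonneg_right h hw.le
      _ = x / w + m := by rw [add_div, mul_div_assoc, div_self hw.ne', mul_one]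
  calc ⌊y / w⌋ ≤ ⌊x / w + m⌋ := Int.floor_le_floor h'
    _ = ⌊x / w⌋ + m := Int.floor_add_natCast _ _

/-- The per-bin inequality `2As ≤ A(A−1) + s(s−1) + 3s` for naturals `A, s`
(`= (A−s)(A−s−1) + 2s ≥ 0`). [folklore] -/
theorem two_mul_mul_le (A s : ℕ) : 2 * (A * s) ≤ (A * A - A) + (s * s - s) + 3 * s := by
  zify [Nat.le_mul_self A, Nat.le_mul_self s]
  rcases le_or_gt A s with h | h
  · nlinarith [sq_nonneg ((A : ℤ) - s)]
  · have h1 : (s : ℤ) + 1 ≤ A := by exact_mod_cast h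
    nlinarith [mul_nonneg (sub_nonneg.2 h1) (show (0 : ℤ) ≤ (A : ℤ) - s by linarith)]

/-- The off-diagonal pairs inside the bin classes `{i ∈ J : ⌊γ i/w⌋ = c k}`, `k ∈ K`, `c`
injective, `J ⊆ I`, are disjointly contained in the off-diagonal same-bin pairs of `I`. [folklore] -/
theorem sum_card_offDiag_filter_le (γ : ℕ → ℝ) (w : ℝ) {I J : Finset ℕ} (hJ : J ⊆ I)
    (K : Finset ℤ) {c : ℤ → ℤ} (hc : Function.Injective c) :
    ∑ k ∈ K, ((J.filter fun i ↦ ⌊γ i / w⌋ = c k).offDiag).card ≤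
      ((I ×ˢ I).filter fun p ↦ p.1 ≠ p.2 ∧ ⌊γ p.1 / w⌋ = ⌊γ p.2 / w⌋).card := by
  rw [← Finset.card_biUnion]
  · apply Finset.card_le_card
    intro p hp
    simp only [Finset.mem_biUnion, Finset.mem_offDiag, Finset.mem_filter] at hp
    obtain ⟨k, -, ⟨h1, hk1⟩, ⟨h2, hk2⟩, hne⟩ := hp
    simp only [Finset.mem_filter, Finset.mem_product]
    exact ⟨⟨hJ h1, hJ h2⟩, hne, hk1.trans hk2.symm⟩
  · intro k₁ _ k₂ _ hne
    rw [Function.onFun, Finset.disjoint_left]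
    intro p hp1 hp2
    simp only [Finset.mem_offDiag, Finset.mem_filter] at hp1 hp2
    exact hne (hc (hp1.1.2.symm.trans hp2.1.2))

/-- For every shift `t`, the pairs `(j, i) ∈ I × S` with `bin j = bin i + t` number at most
`E₀ + (3/2)·#S`, `E₀` the off-diagonal same-bin pairs of `I` (`S ⊆ I`): decompose by the bin of
`i` and apply `two_mul_mul_le` in each bin. [folklore] -/
theorem two_mul_card_shift_le (γ : ℕ → ℝ) (w : ℝ) {I S : Finset ℕ} (hS : S ⊆ I) (t : ℤ) :
    2 * ((I ×ˢ S).filter fun p ↦ ⌊γ p.1 / w⌋ = ⌊γ p.2 / w⌋ + t).card ≤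
      2 * ((I ×ˢ I).filter fun p ↦ p.1 ≠ p.2 ∧ ⌊γ p.1 / w⌋ = ⌊γ p.2 / w⌋).card + 3 * S.card := by
  set G := (I ×ˢ S).filter fun p ↦ ⌊γ p.1 / w⌋ = ⌊γ p.2 / w⌋ + t with hG
  set E := (I ×ˢ I).filter fun p ↦ p.1 ≠ p.2 ∧ ⌊γ p.1 / w⌋ = ⌊γ p.2 / w⌋ with hE
  set K := S.image fun i ↦ ⌊γ i / w⌋ with hK
  -- bin classes
  set cI : ℤ → Finset ℕ := fun k ↦ I.filter fun i ↦ ⌊γ i / w⌋ = k with hcI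
  set cS : ℤ → Finset ℕ := fun k ↦ S.filter fun i ↦ ⌊γ i / w⌋ = k with hcS
  have hdecomp : G.card = ∑ k ∈ K, (G.filter fun p ↦ ⌊γ p.2 / w⌋ = k).card := by
    refine Finset.card_eq_sum_card_fiberwise fun p hp ↦ ?_
    rw [Finset.mem_coe, hG, Finset.mem_filter, Finset.mem_product] at hp
    exact Finset.mem_coe.2 (Finset.mem_image_of_mem _ hp.1.2)
  have hfib : ∀ k ∈ K, (G.filter fun p ↦ ⌊γ p.2 / w⌋ = k).card ≤ (cI (k + t)).card * (cS k).card := by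
    intro k _
    rw [← Finset.card_product]
    apply Finset.card_le_card
    intro p hp
    simp only [hG, Finset.mem_filter, Finset.mem_product] at hp
    simp only [hcI, hcS, Finset.mem_product, Finset.mem_filter]
    obtain ⟨⟨⟨h1, h2⟩, h3⟩, h4⟩ := hp
    exact ⟨⟨h1, by rw [h3, h4]⟩, h2, h4⟩
  have hS' : ∑ k ∈ K, (cS k).card = S.card :=
    (Finset.card_eq_sum_card_image (fun i ↦ ⌊γ i / w⌋) S).symm
  have h1 : ∑ k ∈ K, ((cS k).offDiag).card ≤ E.card := by
    simpa using sum_card_offDiag_filter_le γ w hS K Function.injective_id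
  have h2 : ∑ k ∈ K, ((cI (k + t)).offDiag).card ≤ E.card :=
    sum_card_offDiag_filter_le γ w subset_rfl K (add_left_injective t)
  calc 2 * G.card = ∑ k ∈ K, 2 * (G.filter fun p ↦ ⌊γ p.2 / w⌋ = k).card := by
        rw [hdecomp, Finset.mul_sum]
    _ ≤ ∑ k ∈ K, (((cI (k + t)).offDiag).card + ((cS k).offDiag).card + 3 * (cS k).card) := by
        refine Finset.sum_le_sum fun k hk ↦ ?_
        rw [Finset.offDiag_card, Finset.offDiag_card]
        exact (Nat.mul_le_mul_left 2 (hfib k hk)).trans (two_mul_mul_le _ _)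
    _ = ∑ k ∈ K, ((cI (k + t)).offDiag).card + ∑ k ∈ K, ((cS k).offDiag).card +
          3 * ∑ k ∈ K, (cS k).card := by
        rw [Finset.sum_add_distrib, Finset.sum_add_distrib, Finset.mul_sum]
    _ ≤ 2 * E.card + 3 * S.card := by rw [hS']; omega

/-- **Binning inequality.** For `a > 0`, bins of width `w > 0` and `d ≤ m w`: twice the number of
ordered pairs `(j, i)` of indices of `I` with `a ≤ γ j − γ i ≤ d` is at most `(m + 1)` times
(`2 E₀ + 3 ·#{left ends}`), where `E₀` counts off-diagonal same-bin pairs and a left end is an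
`i ∈ I` with some `j ∈ I`, `a ≤ γ j − γ i ≤ d` (cover the pairs by the bin offset
`t ∈ {0, …, m}` and use `two_mul_card_shift_le`). [folklore] -/
theorem two_mul_card_window_le (γ : ℕ → ℝ) {w a d : ℝ} (I : Finset ℕ) (ha : 0 < a) (hw : 0 < w)
    (m : ℕ) (hd : d ≤ m * w) :
    2 * ((I ×ˢ I).filter fun p ↦ a ≤ γ p.1 - γ p.2 ∧ γ p.1 - γ p.2 ≤ d).card ≤
      (m + 1) * (2 * ((I ×ˢ I).filter fun p ↦ p.1 ≠ p.2 ∧ ⌊γ p.1 / w⌋ = ⌊γ p.2 / w⌋).card +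
        3 * (I.filter fun i ↦ ∃ j ∈ I, a ≤ γ j - γ i ∧ γ j - γ i ≤ d).card) := by
  set S := I.filter fun i ↦ ∃ j ∈ I, a ≤ γ j - γ i ∧ γ j - γ i ≤ d with hS_def
  set E := (I ×ˢ I).filter fun p ↦ p.1 ≠ p.2 ∧ ⌊γ p.1 / w⌋ = ⌊γ p.2 / w⌋ with hE
  set G : ℤ → Finset (ℕ × ℕ) := fun t ↦ (I ×ˢ S).filter fun p ↦ ⌊γ p.1 / w⌋ = ⌊γ p.2 / w⌋ + t
    with hG
  have hS : S ⊆ I := Finset.filter_subset _ _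
  have hcover : ((I ×ˢ I).filter fun p ↦ a ≤ γ p.1 - γ p.2 ∧ γ p.1 - γ p.2 ≤ d) ⊆
      (Finset.range (m + 1)).biUnion fun t ↦ G t := by
    intro p hp
    simp only [Finset.mem_filter, Finset.mem_product] at hp
    obtain ⟨⟨h1, h2⟩, h3, h4⟩ := hp
    rw [Finset.mem_biUnion]
    have hlo : ⌊γ p.2 / w⌋ ≤ ⌊γ p.1 / w⌋ :=
      Int.floor_le_floor (div_le_div_of_nonneg_right (by linarith) hw.le)
    have hhi : ⌊γ p.1 / w⌋ ≤ ⌊γ p.2 / w⌋ + m := floor_div_le_floor_div_add hw (by linarith)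
    refine ⟨(⌊γ p.1 / w⌋ - ⌊γ p.2 / w⌋).toNat, ?_, ?_⟩
    · rw [Finset.mem_range]; omega
    · simp only [hG, Finset.mem_filter, Finset.mem_product]
      refine ⟨⟨h1, ?_⟩, by omega⟩
      rw [hS_def, Finset.mem_filter]
      exact ⟨h2, p.1, h1, h3, h4⟩
  calc 2 * ((I ×ˢ I).filter fun p ↦ a ≤ γ p.1 - γ p.2 ∧ γ p.1 - γ p.2 ≤ d).card
      ≤ 2 * ∑ t ∈ Finset.range (m + 1), (G t).card :=
        Nat.mul_le_mul_left 2 ((Finset.card_le_card hcover).trans Finset.card_biUnion_le)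
    _ = ∑ t ∈ Finset.range (m + 1), 2 * (G t).card := Finset.mul_sum _ _ _
    _ ≤ ∑ _t ∈ Finset.range (m + 1), (2 * E.card + 3 * S.card) :=
        Finset.sum_le_sum fun t _ ↦ two_mul_card_shift_le γ w hS _
    _ = (m + 1) * (2 * E.card + 3 * S.card) := by
        rw [Finset.sum_const, Finset.card_range, smul_eq_mul]

/-- **From left ends to consecutive gaps.** For a monotone `γ`, an initial segment `range N` and
`a > 0`: a left end `i` (some `j < N` has `a ≤ γ j − γ i ≤ d`) has either
`0 < γ (i+1) − γ i ≤ d`, or `γ (i+1) = γ i` with `i + 1 < N`, and the latter inject into the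
off-diagonal same-bin pairs via `i ↦ (i+1, i)`. [folklore] -/
theorem card_leftEnds_le {γ : ℕ → ℝ} (hγ : Monotone γ) (w : ℝ) (N : ℕ) {a d : ℝ} (ha : 0 < a) :
    ((Finset.range N).filter fun i ↦
        ∃ j ∈ Finset.range N, a ≤ γ j - γ i ∧ γ j - γ i ≤ d).card ≤
      ((Finset.range N).filter fun i ↦ 0 < γ (i + 1) - γ i ∧ γ (i + 1) - γ i ≤ d).card +
        ((Finset.range N ×ˢ Finset.range N).filter fun p ↦
          p.1 ≠ p.2 ∧ ⌊γ p.1 / w⌋ = ⌊γ p.2 / w⌋).card := by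
  set I := Finset.range N with hI
  set S := I.filter fun i ↦ ∃ j ∈ I, a ≤ γ j - γ i ∧ γ j - γ i ≤ d with hS
  set Good := I.filter fun i ↦ 0 < γ (i + 1) - γ i ∧ γ (i + 1) - γ i ≤ d with hGood
  set E := (I ×ˢ I).filter fun p ↦ p.1 ≠ p.2 ∧ ⌊γ p.1 / w⌋ = ⌊γ p.2 / w⌋ with hE
  set Rep := S.filter fun i ↦ γ (i + 1) = γ i with hRep
  have hstep : ∀ i ∈ S, (i ∈ I ∧ i + 1 ∈ I) ∧ γ (i + 1) ≤ γ i + d := by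
    intro i hi
    rw [hS, Finset.mem_filter] at hi
    obtain ⟨hiI, j, hjI, h1, h2⟩ := hi
    rw [hI, Finset.mem_range] at hiI hjI
    have hij : i < j := by
      by_contra h
      have := hγ (not_lt.1 h)
      linarith
    refine ⟨⟨by rw [hI, Finset.mem_range]; omega, by rw [hI, Finset.mem_range]; omega⟩, ?_⟩
    have := hγ (Nat.succ_le_of_lt hij)
    linarith
  have hsub : S ⊆ Good ∪ Rep := by
    intro i hi
    obtain ⟨⟨hiI, -⟩, hd'⟩ := hstep i hi
    rw [Finset.mem_union]
    by_cases h : γ (i + 1) = γ i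
    · exact Or.inr (Finset.mem_filter.2 ⟨hi, h⟩)
    · left
      rw [hGood, Finset.mem_filter]
      have hle : γ i ≤ γ (i + 1) := hγ (Nat.le_succ i)
      exact ⟨hiI, sub_pos.2 (lt_of_le_of_ne hle (Ne.symm h)), by linarith⟩
  have hRepc : Rep.card ≤ E.card := by
    refine Finset.card_le_card_of_injOn (fun i ↦ (i + 1, i)) (fun i hi ↦ ?_)
      (fun i _ j _ h ↦ (Prod.ext_iff.1 h).2)
    rw [Finset.mem_coe, hRep, Finset.mem_filter] at hi
    obtain ⟨hiS, heq⟩ := hi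
    obtain ⟨⟨hiI, hi1⟩, -⟩ := hstep i hiS
    rw [Finset.mem_coe, hE, Finset.mem_filter, Finset.mem_product]
    exact ⟨⟨hi1, hiI⟩, Nat.succ_ne_self i, by rw [heq]⟩
  calc S.card ≤ (Good ∪ Rep).card := Finset.card_le_card hsub
    _ ≤ Good.card + Rep.card := Finset.card_union_le _ _
    _ ≤ Good.card + E.card := by omega


/-! ## The zeros of `ζ` -/

/-- The window pairs with Montgomery's windows are counted by `pairCorrelationCount`. [folklore] -/
theorem card_window_eq_pairCorrelationCount (α β T : ℝ) :
    ((zeroIndexSet T ×ˢ zeroIndexSet T).filter fun p ↦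
        2 * π * α / Real.log T ≤ zetaOrdinate p.1 - zetaOrdinate p.2 ∧
          zetaOrdinate p.1 - zetaOrdinate p.2 ≤ 2 * π * β / Real.log T).card =
      pairCorrelationCount α β T := by
  unfold pairCorrelationCount
  rfl

/-- Off-diagonal same-bin pairs (bins of width `2πη / log T`) together with the diagonal lie in
Montgomery's window `[−η, η]`: `E₀ + N(T) ≤ pairCorrelationCount (−η) η T`. [folklore] -/
theorem card_sameBin_add_card_le {T η : ℝ} (hη : 0 < η) (hL : 0 < Real.log T) :
    ((zeroIndexSet T ×ˢ zeroIndexSet T).filter fun p ↦ p.1 ≠ p.2 ∧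
        ⌊zetaOrdinate p.1 / (2 * π * η / Real.log T)⌋ =
          ⌊zetaOrdinate p.2 / (2 * π * η / Real.log T)⌋).card +
        (zeroIndexSet T).card ≤ pairCorrelationCount (-η) η T := by
  set w := 2 * π * η / Real.log T with hw_def
  have hw : 0 < w := by positivity
  have hneg : 2 * π * -η / Real.log T = -w := by rw [hw_def]; ring
  set E := (zeroIndexSet T ×ˢ zeroIndexSet T).filter fun p ↦ p.1 ≠ p.2 ∧
    ⌊zetaOrdinate p.1 / w⌋ = ⌊zetaOrdinate p.2 / w⌋ with hE
  have hdisj : Disjoint E (zeroIndexSet T).diag := by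
    rw [Finset.disjoint_left]
    intro p hp hp'
    rw [hE, Finset.mem_filter] at hp
    exact hp.2.1 (Finset.mem_diag.1 hp').2
  rw [← Finset.diag_card (zeroIndexSet T), ← Finset.card_union_of_disjoint hdisj,
    pairCorrelationCount]
  apply Finset.card_le_card
  intro p hp
  rw [Finset.mem_filter, Finset.mem_product]
  rcases Finset.mem_union.1 hp with hp | hp
  · rw [hE, Finset.mem_filter, Finset.mem_product] at hp
    obtain ⟨hpI, -, hbin⟩ := hp
    have h := abs_lt.1 (abs_sub_lt_of_floor_div_eq hw hbin)
    exact ⟨hpI, by rw [hneg]; exact h.1.le, h.2.le⟩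
  · obtain ⟨h1, h2⟩ := Finset.mem_diag.1 hp
    refine ⟨⟨h1, h2 ▸ h1⟩, ?_, ?_⟩
    · rw [hneg, h2, sub_self, neg_nonpos]; exact hw.le
    · rw [h2, sub_self]; exact hw.le

/-- Consecutive ordinates with `0 < γ_{n+1} − γ_n ≤ 2πβ / log T` and `γ_n ≤ T` have normalised
gap `0 < δ_n ≤ β ≤ μ` (`14 < γ_n ≤ T`, so `0 < log γ_n ≤ log T`). [folklore] -/
theorem filter_gap_subset {T β μ : ℝ} (hβ : 0 < β) (hβμ : β ≤ μ) :
    ((zeroIndexSet T).filter fun n ↦ 0 < zetaOrdinate (n + 1) - zetaOrdinate n ∧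
        zetaOrdinate (n + 1) - zetaOrdinate n ≤ 2 * π * β / Real.log T) ⊆
      ((zeroIndexSet T).filter fun n ↦ 0 < zetaNormalizedGap n ∧ zetaNormalizedGap n ≤ μ) := by
  intro n hn
  rw [Finset.mem_filter] at hn ⊢
  obtain ⟨hnI, hpos, hle⟩ := hn
  have hmem : mem_zeroIndexSet_iff := mem_zeroIndexSet_iff_holds
  have hnT : zetaOrdinate n ≤ T := hmem.1 hnI
  have h14 : (14 : ℝ) < zetaOrdinate 0 := fourteen_lt_zetaOrdinate_zero_holds
  have hmono : Monotone zetaOrdinate := zetaOrdinate_mono_holds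
  have h1n : 1 < zetaOrdinate n := by linarith [hmono (Nat.zero_le n)]
  have hl0 : 0 < Real.log (zetaOrdinate n) := Real.log_pos h1n
  have hL : 0 < Real.log T := Real.log_pos (h1n.trans_le hnT)
  have hlL : Real.log (zetaOrdinate n) ≤ Real.log T := Real.log_le_log (by linarith) hnT
  refine ⟨hnI, ?_, ?_⟩
  · rw [zetaNormalizedGap_eq_mul_div]; positivity
  · rw [zetaNormalizedGap_eq_mul_div, div_le_iff₀ (by positivity)]
    calc (zetaOrdinate (n + 1) - zetaOrdinate n) * Real.log (zetaOrdinate n)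
        ≤ 2 * π * β / Real.log T * Real.log T := mul_le_mul hle hlL hl0.le (by positivity)
      _ = β * (2 * π) := by field_simp
      _ ≤ μ * (2 * π) := by gcongr

end PairCorrelationSmallGaps

open PairCorrelationSmallGaps in
/-- **Pair correlation gives small gaps at every scale, for a positive proportion of zeros.**
Assume Montgomery's pair correlation conjecture `MontgomeryPairCorrelation` (Montgomery 1973,
(12); the `N(T)`-normalised form with the `δ`-term, a statement about the ordinates — no Riemann
Hypothesis is needed for this deduction). Then for every `μ > 0` there are `A > 0` and `T₀` with
`A · N(T) ≤ #{n < N(T) : 0 < (γ_{n+1} − γ_n)/(2π/log γ_n) ≤ μ}` for all `T ≥ T₀` — in the idiom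
of `selberg_fujii_small_gaps` (Titchmarsh §9.25), with consecutive *distinct* ordinates. This is
the deduction behind Bombieri–Garrett 2020, §7.5 ("assuming the Riemann Hypothesis and pair
correlation … the asymptotic fraction of pairs of zeros within half the average spacing … is
`≈ 0.11315 > 0` … for at least one of every such pair …"); see the module docstring for the
proof (binning at scale `β/10`, `β = min μ 3/10`; `A = β³/200`). [cite: BombieriGarrett2020, §7.5] -/
theorem MontgomeryPairCorrelation.smallGaps (hpc : MontgomeryPairCorrelation) {μ : ℝ}
    (hμ : 0 < μ) :
    ∃ A : ℝ, 0 < A ∧ ∃ T₀ : ℝ, ∀ T : ℝ, T₀ ≤ T →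
      A * (zetaZeroCount T : ℝ) ≤
        (((zeroIndexSet T).filter fun n ↦
          0 < zetaNormalizedGap n ∧ zetaNormalizedGap n ≤ μ).card : ℝ) := by
  -- parameters: `β = min μ (3/10)`, windows `[β/2, β]` and `[−β/10, β/10]`
  set β : ℝ := min μ (3 / 10) with hβ_def
  have hβ0 : 0 < β := lt_min hμ (by norm_num)
  have hβμ : β ≤ μ := min_le_left _ _
  have hβ3 : β ≤ 3 / 10 := min_le_right _ _
  have hb3 : 0 < β ^ 3 := pow_pos hβ0 3
  have hc₁ : 7 * β ^ 3 / 24 ≤ ∫ u in (β / 2)..β, (1 - sineKernel u ^ 2) := by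
    calc 7 * β ^ 3 / 24 = (β ^ 3 - (β / 2) ^ 3) / 3 := by ring
      _ ≤ _ := integral_sineGap_ge (half_pos hβ0) (by linarith) hβ3
  have hc₂ : ∫ u in (-(β / 10))..(β / 10), (1 - sineKernel u ^ 2) ≤ β ^ 3 / 300 := by
    calc _ ≤ 10 * (β / 10) ^ 3 / 3 := integral_sineGap_le (by positivity)
      _ = β ^ 3 / 300 := by ring
  have hlim₁ := hpc (β / 2) β (by linarith)
  have hlim₂ := hpc (-(β / 10)) (β / 10) (by linarith)
  rw [if_neg (fun h ↦ by rw [Set.mem_Icc] at h; linarith [h.1]), add_zero] at hlim₁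
  rw [if_pos (Set.mem_Icc.2 ⟨by linarith, by linarith⟩)] at hlim₂
  have hev₁ := hlim₁.eventually_const_lt (show 7 * β ^ 3 / 24 - β ^ 3 / 300 < _ by linarith)
  have hev₂ := hlim₂.eventually_lt_const (show _ < β ^ 3 / 300 + 1 + β ^ 3 / 300 by linarith)
  obtain ⟨T₀, hT₀⟩ := eventually_atTop.1 (hev₁.and (hev₂.and (eventually_gt_atTop (1 : ℝ))))
  refine ⟨β ^ 3 / 200, by positivity, T₀, fun T hT ↦ ?_⟩
  obtain ⟨h₁, h₂, h₃⟩ := hT₀ T hT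
  have hL : 0 < Real.log T := Real.log_pos h₃
  rcases Nat.eq_zero_or_pos (zetaZeroCount T) with hN0 | hNpos
  · rw [hN0, Nat.cast_zero, mul_zero]; positivity
  have hNr : (0 : ℝ) < zetaZeroCount T := by exact_mod_cast hNpos
  rw [lt_div_iff₀ hNr] at h₁
  rw [div_lt_iff₀ hNr] at h₂
  -- the counts
  set w : ℝ := 2 * π * (β / 10) / Real.log T with hw_def
  have hw : 0 < w := by positivity
  set I := zeroIndexSet T with hI
  set E := (I ×ˢ I).filter fun p ↦ p.1 ≠ p.2 ∧ ⌊zetaOrdinate p.1 / w⌋ = ⌊zetaOrdinate p.2 / w⌋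
    with hE
  set S := I.filter fun i ↦ ∃ j ∈ I, 2 * π * (β / 2) / Real.log T ≤ zetaOrdinate j - zetaOrdinate i ∧
    zetaOrdinate j - zetaOrdinate i ≤ 2 * π * β / Real.log T with hS
  set G := I.filter fun n ↦ 0 < zetaOrdinate (n + 1) - zetaOrdinate n ∧
    zetaOrdinate (n + 1) - zetaOrdinate n ≤ 2 * π * β / Real.log T with hG
  set Tg := I.filter fun n ↦ 0 < zetaNormalizedGap n ∧ zetaNormalizedGap n ≤ μ with hTg
  have hk₃ : E.card + zetaZeroCount T ≤ pairCorrelationCount (-(β / 10)) (β / 10) T := by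
    have := card_sameBin_add_card_le (T := T) (η := β / 10) (by positivity) hL
    rwa [card_zeroIndexSet] at this
  have hk₄ : 2 * pairCorrelationCount (β / 2) β T ≤ (10 + 1) * (2 * E.card + 3 * S.card) := by
    have := two_mul_card_window_le zetaOrdinate I (a := 2 * π * (β / 2) / Real.log T)
      (d := 2 * π * β / Real.log T) (by positivity) hw 10 (le_of_eq (by rw [hw_def]; ring))
    rwa [card_window_eq_pairCorrelationCount] at this
  have hk₅ : S.card ≤ G.card + E.card :=
    card_leftEnds_le zetaOrdinate_mono_holds w (zetaZeroCount T) (by positivity)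
  have hk₆ : G.card ≤ Tg.card := Finset.card_le_card (filter_gap_subset hβ0 hβμ)
  -- cast to `ℝ` and conclude by linear arithmetic
  have hk₃' : (E.card : ℝ) + zetaZeroCount T ≤ pairCorrelationCount (-(β / 10)) (β / 10) T := by
    exact_mod_cast hk₃
  have hk₄' : (2 : ℝ) * pairCorrelationCount (β / 2) β T ≤ (10 + 1) * (2 * E.card + 3 * S.card) := by
    exact_mod_cast hk₄
  have hk₅' : (S.card : ℝ) ≤ G.card + E.card := by exact_mod_cast hk₅
  have hk₆' : (G.card : ℝ) ≤ Tg.card := by exact_mod_cast hk₆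
  linarith

end Literature.NumberTheory.LFunctions

end
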